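import Literature.AnabelianGeometry.EtaleTheta.ThetaCoversModelHeisenberg
import Literature.AnabelianGeometry.EtaleTheta.Discharge.Sec2DeltaThetaTorsionFree
import Literature.AnabelianGeometry.EtaleTheta.Discharge.Sec2FreeGenerators
import HarnessLib

/-!
# [EtTh] §2 at the §1 MODEL, phase 1a numerology (part 2): `[Δ̄_Θ-preimage : Ker(Δ_X ↠ Δ̄_X)] = l` and
# `Δ_X / Δ̄_Θ-preimage ≅ (ℤ/lℤ)²` for the profinite free `Δ_X` (proof-only)

Mochizuki, *The étale theta function …* [EtTh], Publ. RIMS **45** (2009), §2, PRIMS PDF p. 35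
(printed p. 261): "`1 → Δ̄_Θ → Δ̄_X → Δ̄^ell_X → 1` — where `Δ̄_Θ ≅ (ℤ/lℤ)(1)`; `Δ̄^ell_X` is a free
`(ℤ/lℤ)`-module of rank `2`" [cite: MochizukiEtTh2009, Def 2.1 p.35]; ERRATUM E1 ([IUTchI] Rmk. 3.1.6):
`l` ODD. PROOF-ONLY companion (seat abc-iut-L2-t10, gen 4; merge row W3-L2-02 / P2-a, L2-lead GO
2026-08-26T02:37:36Z) of `ThetaCoversModelDefs.lean` / `ThetaCoversModelHeisenberg.lean`; nothing of
another seat is edited or restated. Consumed BY NAME: abc-iut-L2-t1's `IsEtThOrigin` /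
`exists_topologicalGenerators` (free profinite `Δ_X` on two generators, p. 12), abc-iut-L2-t8's class-two
normal forms (`DtpYAbelian.commutator_le_zpowers_of_classTwo`).

WHAT IS PROVED (the two numerical fields of `ThetaCovers.CoverData` at the model, under the vacuity
guard `D.IsEtThOrigin`):
* `ThetaSetting.IsEtThOrigin.relIndex_barKerHat : (D.barKerHat l).relIndex (D.barThetaHat l) = l`
  for `l` odd — "`Δ̄_Θ ≅ (ℤ/lℤ)(1)`" as a COUNT (`CoverData.relIndex_barKer`): the `Δ̄_Θ`-preimage is
  `[a,b]^ℤ · Ker` (class-two normal forms + density), and `[a, b]` has order exactly `l` modulo `Ker`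
  (the mod-`l` Heisenberg quotient of `Δ_X` kills `Ker` but not `[a, b]^k`, `0 < k < l`);
* `ThetaSetting.IsEtThOrigin.nonempty_quotient_barThetaHat_mulEquiv :
  Nonempty (↥D.DeltaHat ⧸ (D.barThetaHat l).subgroupOf D.DeltaHat ≃* Multiplicative (ZMod l × ZMod l))`
  for `l ≠ 0` — "`Δ̄^ell_X` is a free `(ℤ/lℤ)`-module of rank `2`" (`CoverData.ell_rank_two`): the continuous
  `Δ_X → (ℤ/l)²`, `a ↦ (1,0)`, `b ↦ (0,1)` kills exactly the `Δ̄_Θ`-preimage (`Δ_X = a^ℤ b^ℤ · barThetaHat`).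
HONEST FRAMING: kernel-checked group theory over abc-iut-L2-t1's data; the theta setting is not asserted
to exist; [EtTh] is refereed; nothing here takes a side on [IUTchIII] Cor. 3.12.
-/

noncomputable section

namespace Literature.AnabelianGeometry.EtaleTheta

open scoped commutatorElement

namespace ThetaSetting

open Literature.AnabelianGeometry.SemiGraphs ZHatLevels ClassTwo DtpYAbelian

variable {p : ℕ} [Fact p.Prime] {D : ThetaSetting p} (l : ℕ)


/-! ### `[barThetaHat : barKerHat] = l` -/

/-- **"`Δ̄_Θ ≅ (ℤ/lℤ)(1)`" as a count**: for a theta setting of [EtTh] origin and `l` odd, the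
`Δ̄_Θ`-preimage has index exactly `l` over `Ker(Δ_X ↠ Δ̄_X)` (the field `CoverData.relIndex_barKer`
at the model). [cite: MochizukiEtTh2009, Def 2.1 p.35] -/
theorem IsEtThOrigin.relIndex_barKerHat (hO : D.IsEtThOrigin) (hodd : Odd l) :
    (D.barKerHat l).relIndex (D.barThetaHat l) = l := by
  classical
  have hl0 : 0 < l := by obtain ⟨k, hk⟩ := hodd; omega
  haveI : CompactSpace D.PiHat := D.isProfiniteCompletion_toHat.compactSpace
  haveI : T2Space D.PiHat := D.isProfiniteCompletion_toHat.t2Space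
  haveI hKn : (D.barKerHat l).Normal := D.barKerHat_normal l
  have hKclosed : IsClosed (D.barKerHat l : Set D.PiHat) := D.isClosed_barKerHat l
  have hKΘ : D.barKerHat l ≤ D.barThetaHat l := D.barKerHat_le_barThetaHat l
  -- the free pair, topologically generating `Δ_X`
  obtain ⟨hcpt, ht2, htd, -⟩ := hO.deltaHat_free
  haveI : CompactSpace D.DeltaHat := hcpt
  obtain ⟨a, b, huniv, hdense⟩ := hO.exists_topologicalGenerators
  set c : D.PiHat := ⁅(a : D.PiHat), (b : D.PiHat)⁆ with hcdef
  have hcΔ : c ∈ D.DeltaHat := by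
    rw [hcdef, commutatorElement_def]
    exact D.DeltaHat.mul_mem (D.DeltaHat.mul_mem (D.DeltaHat.mul_mem a.2 b.2)
      (D.DeltaHat.inv_mem a.2)) (D.DeltaHat.inv_mem b.2)
  have hc' : (⁅a, b⁆ : D.DeltaHat) = ⟨c, hcΔ⟩ := Subtype.ext (by
    simp only [commutatorElement_def, Subgroup.coe_mul, Subgroup.coe_inv, hcdef])
  have hcΘ : c ∈ D.barThetaHat l :=
    D.commutator_le_barThetaHat l (Subgroup.commutator_mem_commutator a.2 b.2)
  -- ### the mod-`l` Heisenberg quotient of `Δ_X`: `c^k ∈ barKer ↔ l ∣ k`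
  obtain ⟨H, hHgrp, hHfin, x, y, horder, hQ3, hexp⟩ := exists_classTwo_exponent_commutator_orderOf l hodd
  letI : Group H := hHgrp
  haveI : Finite H := hHfin
  letI : TopologicalSpace H := ⊥
  haveI : DiscreteTopology H := ⟨rfl⟩
  obtain ⟨F, ⟨hFa, hFb⟩, -⟩ := huniv H x y
  have hFc : Continuous F.toMonoidHom := F.continuous_toFun
  have hFcpow : ∀ k : ℕ, F (⟨c, hcΔ⟩ ^ k) = (⁅x, y⁆ : H) ^ k := by
    intro k; rw [map_pow, ← hc', map_commutatorElement, hFa, hFb]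
  have hck : ∀ k : ℕ, c ^ k ∈ D.barKerHat l → l ∣ k := by
    intro k hk
    have h1 : F (⟨c, hcΔ⟩ ^ k) = 1 :=
      apply_eq_one_of_mem_barKerHat l F.toMonoidHom hFc hQ3 hexp (by simpa using hk)
    rw [hFcpow] at h1
    rw [← horder]
    exact orderOf_dvd_of_pow_eq_one h1
  have hcl : c ^ l ∈ D.barKerHat l := D.pow_mem_barKerHat l hcΔ
  -- ### `barThetaHat ≤ c^ℤ · barKerHat` (a closed subgroup of `Π_X`)
  let U : Subgroup D.PiHat :=
    { carrier := {g | ∃ k : ℤ, ∃ m ∈ D.barKerHat l, g = c ^ k * m}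
      one_mem' := ⟨0, 1, one_mem _, by simp⟩
      mul_mem' := by
        rintro _ _ ⟨k, m, hm, rfl⟩ ⟨k', m', hm', rfl⟩
        refine ⟨k + k', (c ^ k')⁻¹ * m * c ^ k' * m', (D.barKerHat l).mul_mem ?_ hm', ?_⟩
        · simpa using hKn.conj_mem m hm (c ^ k')⁻¹
        · rw [zpow_add]; group
      inv_mem' := by
        rintro _ ⟨k, m, hm, rfl⟩
        refine ⟨-k, c ^ k * m⁻¹ * (c ^ k)⁻¹, hKn.conj_mem _ ((D.barKerHat l).inv_mem hm) _, ?_⟩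
        rw [zpow_neg]; group }
  have hU_mem : ∀ g, g ∈ U ↔ ∃ k : ℤ, ∃ m ∈ D.barKerHat l, g = c ^ k * m := fun g => Iff.rfl
  have hKU : D.barKerHat l ≤ U := fun m hm => ⟨0, m, hm, by simp⟩
  -- closedness: `U` is the finite union of the closed cosets `c^k · barKer`, `0 ≤ k < l`
  have hUclosed : IsClosed (U : Set D.PiHat) := by
    have hcl' : c ^ (l : ℤ) ∈ D.barKerHat l := by rw [zpow_natCast]; exact hcl
    have hl0' : (l : ℤ) ≠ 0 := by exact_mod_cast hl0.ne'
    have hcover : (U : Set D.PiHat) =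
        ⋃ k ∈ Finset.range l, (fun m : D.PiHat => c ^ (k : ℤ) * m) '' (D.barKerHat l : Set D.PiHat) := by
      ext g
      simp only [SetLike.mem_coe, hU_mem, Set.mem_iUnion, Set.mem_image, Finset.mem_range]
      constructor
      · rintro ⟨k, m, hm, rfl⟩
        refine ⟨(k % l).toNat, ?_, (c ^ (l : ℤ)) ^ (k / l) * m,
          (D.barKerHat l).mul_mem (Subgroup.zpow_mem _ hcl' _) hm, ?_⟩
        · have := Int.emod_lt_of_pos k (by exact_mod_cast hl0 : (0 : ℤ) < l)
          have h0 := Int.emod_nonneg k hl0'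
          omega
        · have hk : c ^ k = c ^ ((k % l).toNat : ℤ) * (c ^ (l : ℤ)) ^ (k / l) := by
            rw [Int.toNat_of_nonneg (Int.emod_nonneg k hl0'), ← zpow_mul, ← zpow_add]
            congr 1
            exact (Int.emod_add_mul_ediv _ _).symm
          rw [hk, mul_assoc]
      · rintro ⟨k, -, m, hm, rfl⟩
        exact ⟨k, m, hm, rfl⟩
    rw [hcover]
    refine isClosed_biUnion_finset fun k _ => ?_
    exact (Homeomorph.mulLeft (c ^ (k : ℤ))).isClosedMap _ hKclosed
  -- commutators of elements of the dense `⟨a, b⟩` lie in `U` (class-two normal forms modulo `barKer`)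
  have hU_comm_gen : ∀ u ∈ Subgroup.closure ({a, b} : Set D.DeltaHat),
      ∀ v ∈ Subgroup.closure ({a, b} : Set D.DeltaHat), ⁅(u : D.PiHat), (v : D.PiHat)⁆ ∈ U := by
    intro u hu v hv
    let π : D.PiHat →* D.PiHat ⧸ D.barKerHat l := QuotientGroup.mk' (D.barKerHat l)
    let A : Subgroup (D.PiHat ⧸ D.barKerHat l) :=
      ((Subgroup.closure ({a, b} : Set D.DeltaHat)).map D.DeltaHat.subtype).map π
    have hAgen : A = Subgroup.closure ({π a, π b} : Set (D.PiHat ⧸ D.barKerHat l)) := by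
      simp only [A, MonoidHom.map_closure, Set.image_pair, Subgroup.coe_subtype]
    have hAle : A ≤ (D.DeltaHat.map π) := Subgroup.map_mono (Subgroup.map_subtype_le _)
    have h3 : ⁅⁅A, A⁆, A⁆ = ⊥ := by
      rw [eq_bot_iff]
      calc ⁅⁅A, A⁆, A⁆ ≤ ⁅⁅D.DeltaHat.map π, D.DeltaHat.map π⁆, D.DeltaHat.map π⁆ :=
            Subgroup.commutator_mono (Subgroup.commutator_mono hAle hAle) hAle
        _ = (⁅⁅D.DeltaHat, D.DeltaHat⁆, D.DeltaHat⁆).map π := by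
            rw [Subgroup.map_commutator, Subgroup.map_commutator]
        _ ≤ (D.barKerHat l).map π := Subgroup.map_mono (D.tripleCommutator_le_barKerHat l)
        _ = ⊥ := by
            rw [eq_bot_iff]
            rintro _ ⟨k, hk, rfl⟩
            exact (QuotientGroup.eq_one_iff k).mpr hk
    have hαA : π a ∈ A := by rw [hAgen]; exact Subgroup.subset_closure (Set.mem_insert _ _)
    have hβA : π b ∈ A := by
      rw [hAgen]; exact Subgroup.subset_closure (Set.mem_insert_of_mem _ (Set.mem_singleton _))
    have hcyc := commutator_le_zpowers_of_classTwo A hαA hβA hAgen.le h3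
    have huA : π u ∈ A := ⟨u, ⟨u, hu, rfl⟩, rfl⟩
    have hvA : π v ∈ A := ⟨v, ⟨v, hv, rfl⟩, rfl⟩
    have hmem : ⁅π u, π v⁆ ∈ Subgroup.zpowers ⁅π a, π b⁆ :=
      hcyc (Subgroup.commutator_mem_commutator huA hvA)
    obtain ⟨m, hm⟩ := Subgroup.mem_zpowers_iff.mp hmem
    rw [← map_commutatorElement, ← map_commutatorElement, ← hcdef, ← map_zpow] at hm
    have hk : (c ^ m)⁻¹ * ⁅(u : D.PiHat), (v : D.PiHat)⁆ ∈ D.barKerHat l := by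
      rw [← QuotientGroup.eq]; exact hm
    exact ⟨m, _, hk, by rw [mul_inv_cancel_left]⟩
  -- all commutators of `Δ_X` lie in `U` (density of `⟨a, b⟩`, closedness of `U`)
  have hU_comm : ⁅D.DeltaHat, D.DeltaHat⁆ ≤ U := by
    refine Subgroup.commutator_le.mpr fun u hu v hv => ?_
    let T : Set (D.DeltaHat × D.DeltaHat) :=
      {q | ⁅((q.1 : D.DeltaHat) : D.PiHat), ((q.2 : D.DeltaHat) : D.PiHat)⁆ ∈ U}
    have hTclosed : IsClosed T := by
      refine hUclosed.preimage ?_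
      have h1 : Continuous fun q : D.DeltaHat × D.DeltaHat => ((q.1 : D.DeltaHat) : D.PiHat) :=
        continuous_subtype_val.comp continuous_fst
      have h2 : Continuous fun q : D.DeltaHat × D.DeltaHat => ((q.2 : D.DeltaHat) : D.PiHat) :=
        continuous_subtype_val.comp continuous_snd
      simp only [commutatorElement_def]
      exact ((h1.mul h2).mul h1.inv).mul h2.inv
    have hAdense : Dense ((Subgroup.closure ({a, b} : Set D.DeltaHat) : Subgroup D.DeltaHat) :
        Set D.DeltaHat) := by
      rw [dense_iff_closure_eq, ← Subgroup.topologicalClosure_coe, hdense, Subgroup.coe_top]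
    have hsub : ((Subgroup.closure ({a, b} : Set D.DeltaHat) : Set D.DeltaHat) ×ˢ
        (Subgroup.closure ({a, b} : Set D.DeltaHat) : Set D.DeltaHat)) ⊆ T := by
      rintro ⟨u', v'⟩ ⟨hu', hv'⟩
      exact hU_comm_gen u' hu' v' hv'
    have hT : T = Set.univ := by
      refine Set.eq_univ_of_univ_subset ?_
      rw [← (hAdense.prod hAdense).closure_eq]
      exact hTclosed.closure_subset_iff.mpr hsub
    have : ((⟨u, hu⟩ : D.DeltaHat), (⟨v, hv⟩ : D.DeltaHat)) ∈ T := by rw [hT]; trivial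
    exact this
  have hΘU : D.barThetaHat l ≤ U :=
    Subgroup.topologicalClosure_minimal _ (sup_le hU_comm ((D.deltaHatPow_le_barKerHat l).trans hKU))
      hUclosed
  -- ### the count: `barTheta / barKer` is cyclic on the class of `c`, of order exactly `l`
  let N : Subgroup (D.barThetaHat l) := (D.barKerHat l).subgroupOf (D.barThetaHat l)
  haveI hNn : N.Normal := inferInstance
  let q : (D.barThetaHat l) ⧸ N := QuotientGroup.mk ⟨c, hcΘ⟩
  have hq_pow : ∀ k : ℕ, q ^ k = 1 ↔ c ^ k ∈ D.barKerHat l := by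
    intro k
    rw [← QuotientGroup.mk_pow, QuotientGroup.eq_one_iff, Subgroup.mem_subgroupOf, Subgroup.coe_pow]
  have horderq : orderOf q = l := by
    rw [orderOf_eq_iff hl0]
    refine ⟨(hq_pow l).2 hcl, fun m hml hm0 hqm => ?_⟩
    have := Nat.le_of_dvd hm0 (hck m ((hq_pow m).1 hqm))
    omega
  have htop : Subgroup.zpowers q = ⊤ := by
    rw [eq_top_iff]
    rintro q' -
    obtain ⟨⟨t, ht⟩, rfl⟩ := QuotientGroup.mk_surjective q'
    obtain ⟨k, m, hm, htm⟩ := (hU_mem t).1 (hΘU ht)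
    subst htm
    refine ⟨k, ?_⟩
    change q ^ k = QuotientGroup.mk ⟨c ^ k * m, ht⟩
    rw [← QuotientGroup.mk_zpow, QuotientGroup.eq, Subgroup.mem_subgroupOf]
    simp only [Subgroup.coe_mul, Subgroup.coe_inv, SubgroupClass.coe_zpow, inv_mul_cancel_left]
    exact hm
  change N.index = l
  rw [Subgroup.index_eq_card, ← Subgroup.card_top, ← htop, Nat.card_zpowers, horderq]

/-! ### `Δ_X / barThetaHat ≅ (ℤ/lℤ)²` -/

/-- **"`Δ̄^ell_X` is a free `(ℤ/lℤ)`-module of rank `2`"**: for a theta setting of [EtTh] origin and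
`l ≠ 0`, `Δ_X` modulo the `Δ̄_Θ`-preimage is `(ℤ/lℤ)²` (the field `CoverData.ell_rank_two` at the
model; the isomorphism sends the free generators `a, b` to `(1,0), (0,1)`). The quotient GROUP needs
the normality of `barThetaHat` as an INSTANCE, taken as an instance-implicit binder (discharge it with
`ThetaSetting.barThetaHat_normal`; inside `ThetaCovers.CoverData` it is the field `barTheta_normal`).
[cite: MochizukiEtTh2009, Def 2.1 p.35] -/
theorem IsEtThOrigin.nonempty_quotient_barThetaHat_mulEquiv (hO : D.IsEtThOrigin) [NeZero l]
    [hΘn : (D.barThetaHat l).Normal] :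
    Nonempty (↥D.DeltaHat ⧸ (D.barThetaHat l).subgroupOf D.DeltaHat ≃*
      Multiplicative (ZMod l × ZMod l)) := by
  classical
  haveI : CompactSpace D.PiHat := D.isProfiniteCompletion_toHat.compactSpace
  haveI : T2Space D.PiHat := D.isProfiniteCompletion_toHat.t2Space
  have hΘclosed : IsClosed (D.barThetaHat l : Set D.PiHat) := D.isClosed_barThetaHat l
  have hΘΔ : D.barThetaHat l ≤ D.DeltaHat := D.barThetaHat_le_deltaHat l
  obtain ⟨hcpt, ht2, htd, -⟩ := hO.deltaHat_free
  haveI : CompactSpace D.DeltaHat := hcpt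
  obtain ⟨a, b, huniv, hdense⟩ := hO.exists_topologicalGenerators
  -- the continuous `φ : Δ_X → (ℤ/l)²`, `a ↦ (1,0)`, `b ↦ (0,1)`
  let M := Multiplicative (ZMod l × ZMod l)
  letI : TopologicalSpace M := ⊥
  haveI : DiscreteTopology M := ⟨rfl⟩
  obtain ⟨φ, ⟨hφa, hφb⟩, -⟩ :=
    huniv M (Multiplicative.ofAdd ((1 : ZMod l), (0 : ZMod l))) (Multiplicative.ofAdd ((0 : ZMod l), (1 : ZMod l)))
  have hφc : Continuous φ.toMonoidHom := φ.continuous_toFun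
  have hexpM : ∀ z : M, z ^ l = 1 := by
    intro z
    rw [← ofAdd_toAdd z, ← ofAdd_nsmul]
    have h0 : l • (Multiplicative.toAdd z) = 0 := by ext <;> simp [nsmul_eq_mul]
    rw [h0, ofAdd_zero]
  -- (α) `barThetaHat` dies under `φ`
  have hΘker : ∀ g : D.DeltaHat, (g : D.PiHat) ∈ D.barThetaHat l → φ g = 1 := fun g hg =>
    apply_eq_one_of_mem_barThetaHat l φ.toMonoidHom hφc hexpM hg
  -- (β) `Δ_X = a^ℤ b^ℤ · barThetaHat`: the subgroup `W` of such products is closed and contains `a, b`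
  let W : Subgroup D.PiHat :=
    { carrier := {g | ∃ i j : ℤ, ∃ t ∈ D.barThetaHat l, g = (a : D.PiHat) ^ i * (b : D.PiHat) ^ j * t}
      one_mem' := ⟨0, 0, 1, one_mem _, by simp⟩
      mul_mem' := by
        rintro _ _ ⟨i, j, t, ht, rfl⟩ ⟨i', j', t', ht', rfl⟩
        -- `b^j a^{i'} = a^{i'} b^j κ` with `κ = [b^{-j}, a^{-i'}] ∈ [Δ_X,Δ_X] ≤ barTheta`
        have hκ : (b : D.PiHat) ^ (-j) * (a : D.PiHat) ^ (-i') * ((b : D.PiHat) ^ (-j))⁻¹ *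
            ((a : D.PiHat) ^ (-i'))⁻¹ ∈ D.barThetaHat l :=
          D.commutator_mem_barThetaHat l (D.DeltaHat.zpow_mem b.2 _) (D.DeltaHat.zpow_mem a.2 _)
        have ht₁ : ((a : D.PiHat) ^ i' * (b : D.PiHat) ^ j')⁻¹ * t * ((a : D.PiHat) ^ i' * (b : D.PiHat) ^ j') ∈
            D.barThetaHat l := hΘn.conj_mem' t ht _
        have hκ' : ((b : D.PiHat) ^ j')⁻¹ * ((b : D.PiHat) ^ (-j) * (a : D.PiHat) ^ (-i') *
            ((b : D.PiHat) ^ (-j))⁻¹ * ((a : D.PiHat) ^ (-i'))⁻¹) * (b : D.PiHat) ^ j' ∈ D.barThetaHat l :=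
          hΘn.conj_mem' _ hκ _
        refine ⟨i + i', j + j', _, (D.barThetaHat l).mul_mem ((D.barThetaHat l).mul_mem hκ' ht₁) ht', ?_⟩
        simp only [zpow_add, zpow_neg]
        group
      inv_mem' := by
        rintro _ ⟨i, j, t, ht, rfl⟩
        have hκ : (b : D.PiHat) ^ j * (a : D.PiHat) ^ i * ((b : D.PiHat) ^ j)⁻¹ * ((a : D.PiHat) ^ i)⁻¹ ∈
            D.barThetaHat l :=
          D.commutator_mem_barThetaHat l (D.DeltaHat.zpow_mem b.2 _) (D.DeltaHat.zpow_mem a.2 _)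
        have ht₂ : ((b : D.PiHat) ^ (-j) * (a : D.PiHat) ^ (-i))⁻¹ * t⁻¹ *
            ((b : D.PiHat) ^ (-j) * (a : D.PiHat) ^ (-i)) ∈ D.barThetaHat l :=
          hΘn.conj_mem' _ ((D.barThetaHat l).inv_mem ht) _
        refine ⟨-i, -j, _, (D.barThetaHat l).mul_mem hκ ht₂, ?_⟩
        simp only [zpow_neg]
        group }
  have hW_mem : ∀ g, g ∈ W ↔ ∃ i j : ℤ, ∃ t ∈ D.barThetaHat l,
      g = (a : D.PiHat) ^ i * (b : D.PiHat) ^ j * t := fun g => Iff.rfl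
  have hal : (a : D.PiHat) ^ (l : ℤ) ∈ D.barThetaHat l := by
    rw [zpow_natCast]; exact D.deltaHatPow_le_barThetaHat l (D.pow_mem_deltaHatPow l a.2)
  have hbl : (b : D.PiHat) ^ (l : ℤ) ∈ D.barThetaHat l := by
    rw [zpow_natCast]; exact D.deltaHatPow_le_barThetaHat l (D.pow_mem_deltaHatPow l b.2)
  have hl0 : 0 < l := Nat.pos_of_ne_zero (NeZero.ne l)
  have hl0' : (l : ℤ) ≠ 0 := by exact_mod_cast hl0.ne'
  -- reduction of exponents modulo `l`
  have hred : ∀ (i j : ℤ) (t : D.PiHat), t ∈ D.barThetaHat l →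
      ∃ t' ∈ D.barThetaHat l, (a : D.PiHat) ^ i * (b : D.PiHat) ^ j * t =
        (a : D.PiHat) ^ ((i % l).toNat : ℤ) * (b : D.PiHat) ^ ((j % l).toNat : ℤ) * t' := by
    intro i j t ht
    have hi : (a : D.PiHat) ^ i = (a : D.PiHat) ^ ((i % l).toNat : ℤ) * ((a : D.PiHat) ^ (l : ℤ)) ^ (i / l) := by
      rw [Int.toNat_of_nonneg (Int.emod_nonneg i hl0'), ← zpow_mul, ← zpow_add]
      congr 1; exact (Int.emod_add_mul_ediv _ _).symm
    have hj : (b : D.PiHat) ^ j = (b : D.PiHat) ^ ((j % l).toNat : ℤ) * ((b : D.PiHat) ^ (l : ℤ)) ^ (j / l) := by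
      rw [Int.toNat_of_nonneg (Int.emod_nonneg j hl0'), ← zpow_mul, ← zpow_add]
      congr 1; exact (Int.emod_add_mul_ediv _ _).symm
    set A := ((a : D.PiHat) ^ (l : ℤ)) ^ (i / l) with hA
    set Bq := ((b : D.PiHat) ^ (l : ℤ)) ^ (j / l) with hB
    have hAm : A ∈ D.barThetaHat l := Subgroup.zpow_mem _ hal _
    have hBm : Bq ∈ D.barThetaHat l := Subgroup.zpow_mem _ hbl _
    -- `a^{i₀} A b^{j₀} B t = a^{i₀} b^{j₀} · (b^{-j₀} A b^{j₀}) B t`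
    refine ⟨((b : D.PiHat) ^ ((j % l).toNat : ℤ))⁻¹ * A * (b : D.PiHat) ^ ((j % l).toNat : ℤ) * Bq * t,
      (D.barThetaHat l).mul_mem ((D.barThetaHat l).mul_mem (hΘn.conj_mem' _ hAm _) hBm) ht, ?_⟩
    rw [hi, hj]
    group
  have hWclosed : IsClosed (W : Set D.PiHat) := by
    have hcover : (W : Set D.PiHat) = ⋃ ij ∈ (Finset.range l ×ˢ Finset.range l),
        (fun t : D.PiHat => (a : D.PiHat) ^ (ij.1 : ℤ) * (b : D.PiHat) ^ (ij.2 : ℤ) * t) ''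
          (D.barThetaHat l : Set D.PiHat) := by
      ext g
      simp only [SetLike.mem_coe, hW_mem, Set.mem_iUnion, Set.mem_image, Finset.mem_product,
        Finset.mem_range, Prod.exists]
      constructor
      · rintro ⟨i, j, t, ht, rfl⟩
        obtain ⟨t', ht', heq⟩ := hred i j t ht
        have h1 : (i % l).toNat < l := by
          have := Int.emod_lt_of_pos i (by exact_mod_cast hl0 : (0 : ℤ) < l)
          have h0 := Int.emod_nonneg i hl0'
          omega
        have h2 : (j % l).toNat < l := by
          have := Int.emod_lt_of_pos j (by exact_mod_cast hl0 : (0 : ℤ) < l)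
          have h0 := Int.emod_nonneg j hl0'
          omega
        exact ⟨(i % l).toNat, (j % l).toNat, ⟨h1, h2⟩, t', ht', heq.symm⟩
      · rintro ⟨i, j, -, t, ht, rfl⟩
        exact ⟨i, j, t, ht, rfl⟩
    rw [hcover]
    refine isClosed_biUnion_finset fun ij _ => ?_
    exact (Homeomorph.mulLeft ((a : D.PiHat) ^ (ij.1 : ℤ) * (b : D.PiHat) ^ (ij.2 : ℤ))).isClosedMap _
      hΘclosed
  -- `Δ_X ≤ W` by density of `⟨a, b⟩` and closedness of `W`
  have hΔW : D.DeltaHat ≤ W := by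
    have hgen : (Subgroup.closure ({a, b} : Set D.DeltaHat)).map D.DeltaHat.subtype ≤ W := by
      rw [MonoidHom.map_closure, Subgroup.closure_le, Set.image_pair]
      rintro _ (rfl | rfl)
      · exact ⟨1, 0, 1, one_mem _, by simp⟩
      · exact ⟨0, 1, 1, one_mem _, by simp⟩
    -- the pull-back of `W` to the subtype `Δ_X` is closed and contains the dense `⟨a, b⟩`
    have hWΔclosed : IsClosed ((W.comap D.DeltaHat.subtype : Subgroup D.DeltaHat) : Set D.DeltaHat) :=
      hWclosed.preimage continuous_subtype_val
    have hle : (Subgroup.closure ({a, b} : Set D.DeltaHat)) ≤ W.comap D.DeltaHat.subtype :=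
      Subgroup.map_le_iff_le_comap.1 hgen
    have htopW : (⊤ : Subgroup D.DeltaHat) ≤ W.comap D.DeltaHat.subtype := by
      rw [← hdense]
      exact Subgroup.topologicalClosure_minimal _ hle hWΔclosed
    intro g hg
    exact htopW (Subgroup.mem_top (⟨g, hg⟩ : D.DeltaHat))
  -- (β) the kernel of `φ` is the `Δ̄_Θ`-preimage
  have hker : φ.toMonoidHom.ker = (D.barThetaHat l).subgroupOf D.DeltaHat := by
    ext g
    rw [MonoidHom.mem_ker, Subgroup.mem_subgroupOf]
    constructor
    · intro hg
      change φ g = 1 at hg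
      obtain ⟨i, j, t, ht, hgt⟩ := (hW_mem _).1 (hΔW g.2)
      have htΔ : t ∈ D.DeltaHat := hΘΔ ht
      have hg' : g = a ^ i * b ^ j * ⟨t, htΔ⟩ := Subtype.ext (by
        simp only [Subgroup.coe_mul, SubgroupClass.coe_zpow]; exact hgt)
      have hφg : φ g = Multiplicative.ofAdd (((i : ZMod l)), ((j : ZMod l))) := by
        rw [hg', map_mul, map_mul, map_zpow, map_zpow, hΘker ⟨t, htΔ⟩ ht, mul_one, hφa, hφb,
          ← ofAdd_zsmul, ← ofAdd_zsmul, ← ofAdd_add]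
        congr 1
        ext <;> simp
      rw [hφg] at hg
      have hij := Multiplicative.ofAdd.injective (hg.trans ofAdd_zero.symm)
      rw [Prod.mk_eq_zero] at hij
      obtain ⟨hi, hj⟩ := hij
      rw [ZMod.intCast_zmod_eq_zero_iff_dvd] at hi hj
      obtain ⟨i₁, rfl⟩ := hi
      obtain ⟨j₁, rfl⟩ := hj
      change (g : D.PiHat) ∈ D.barThetaHat l
      rw [hgt, zpow_mul, zpow_mul]
      exact (D.barThetaHat l).mul_mem ((D.barThetaHat l).mul_mem (Subgroup.zpow_mem _ hal _)
        (Subgroup.zpow_mem _ hbl _)) ht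
    · intro hg
      exact hΘker g hg
  -- (γ) surjectivity
  have hsurj : Function.Surjective φ.toMonoidHom := by
    intro z
    refine ⟨a ^ ((Multiplicative.toAdd z).1.val : ℤ) * b ^ ((Multiplicative.toAdd z).2.val : ℤ), ?_⟩
    rw [map_mul, map_zpow, map_zpow]
    change φ a ^ _ * φ b ^ _ = z
    rw [hφa, hφb, ← ofAdd_zsmul, ← ofAdd_zsmul, ← ofAdd_add, ← ofAdd_toAdd z]
    congr 1
    ext <;> simp
  -- (δ) assembly
  exact ⟨(QuotientGroup.quotientMulEquivOfEq hker).symm.trans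
    (QuotientGroup.quotientKerEquivOfSurjective φ.toMonoidHom hsurj)⟩

end ThetaSetting

end Literature.AnabelianGeometry.EtaleTheta

end
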